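import Mathlib
import HarnessLib
import Summits.ResolutionOfSingularities.ResolutionOfSingularities.Theorems.WildQuotientsWildQuotientResolutionS1aA1Root

/-!
# S1a — INSTANCE I-2 (a1), ring level, MOVE 2 of MT-a1″: on the norm chart's model ring the (2,1)-centre `(X₀′, x₂)` is admissible relative to `β = s` with shift 1, and its residual ideal contains `Y₀·s`, `Y₀·s₂`, `X₁′·Y₂`

[OURS · L1 W4.5c · lead-1 g12; plan-1 RULING R-F15c «I-2 := MT-a1″: move 2 in N(x₂): (x₁′:2, x₃:1; δ1); N(x₃) KILLED, [x₁′]₂ residual V(η₂, τ, e₁)», my F13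
(`aug = ss₂·(Y₁s, Y₁s₂, X₂Y₃)`), FRAME-STATUS rev15 §3] — NOT statements of the manuscript; counted 0; AI-level work, weaker than expert review. Crux
stmt-ResolutionOfSingularities-17941 `CyclicQuotientFourfolds`, line `s1a-logminvertex` v13 (`stub_reachLowerInFX`).

ABSTRACT SETTING (the model ring of the norm chart of move 1, 0-indexed as in `…S1aA1Root`): a commutative ring `P` with elements `s` (= `e₁`, the exceptional
parameter of move 1), `X₀` (= `x₀T²`), `X₁` (= `x₁T`), `x₂`, `x₃` and an automorphism `τ` with the rows of F13 / `…S1aA1Model`: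
`τ s = s`, `τ X₀ = X₀`, `τ X₁ = X₁ + X₀·s`, `τ x₂ = x₂ + s²·X₀`, `τ x₃ = x₃ + s·X₁·x₂`, all further ring generators `τ`-FIXED (constants, the inverted norm).
The centre of move 2 is `f′ = (X₀, x₂)` with weights `(2, 1)`, boundary `β = s`, shift `δ = 1`.
* `a1m2_admissible` — (a′)₁ relative to `β = s`: `y ∈ 𝒥ₙ ⇒ τ y − y ∈ (s)·𝒥ₙ₊₁` (rows: `x₂ ↦ s·(sX₀) ∈ s𝒥₂`, `X₁ ↦ s·X₀ ∈ s𝒥₂ ⊆ s𝒥₁`, `x₃ ↦ s·(X₁x₂) ∈ s𝒥₁`);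
  `a1m2_map_le` (`τ`-stability);
* ★ `a1m2_augmentationIdeal_sigmaR_le` — (H1) on `R^w(P)`: `aug σ_R ≤ (s·s₂)` (`s₂ = T₂⁻¹`);
* ★ `a1m2_residual_mem₁/₂/₃` — the residual ideal `𝔞₂ = (aug σ_R : s·s₂)` contains `Y₀·s` (`Y₀ = X₀T₂²`), `Y₀·s₂` and `X₁·Y₂` (`Y₂ = x₂T₂`) — F13's
  `𝔞₂ ⊇ (Y₀s, Y₀s₂, X₁Y₂)`: on the `[X₀]₂` chart (`Y₀`, `X₁` units) its zero set is the curve `C″ = V(s, s₂, Y₂)`; on the `N(x₂)` chart (`Y₂` unit) it is empty.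
K1′ for `(X₀, x₂)` is NOT here (it depends on the concrete model `Localization.Away h₁ (MvPolynomial (Option (Fin 4)) k)`).
-/

set_option linter.dupNamespace false

noncomputable section

open Literature.AlgebraicGeometry.Resolution
open scoped LaurentPolynomial
open Summit.ResolutionOfSingularities.ResolutionOfSingularities.Theorems.WildQuotientResolution.S1.CoarseChart
open Summit.ResolutionOfSingularities.ResolutionOfSingularities.Theorems.WildQuotientResolution.S1.BlowupCharts

namespace Summit.ResolutionOfSingularities.ResolutionOfSingularities.Theorems.WildQuotientResolution.S1.KillCert.A1

variable {P : Type} [CommRing P] (τ : P ≃+* P) (s X₀ X₁ x₂ x₃ : P) (Gfix : Set P)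
  (hs : τ s = s) (hX₀ : τ X₀ = X₀) (hX₁ : τ X₁ = X₁ + X₀ * s) (hx₂ : τ x₂ = x₂ + s ^ 2 * X₀) (hx₃ : τ x₃ = x₃ + s * X₁ * x₂)
  (hfix : ∀ g ∈ Gfix, τ g = g) (hgen : Subring.closure (({s, X₀, X₁, x₂, x₃} : Set P) ∪ Gfix) = ⊤)

/-! ## (a′)₁ relative to `β = s` -/

include hs hX₀ hX₁ hx₂ hx₃ hfix hgen in
/-- **(a′)₁ for move 2 of MT-a1″**: `y ∈ 𝒥ₙ((X₀, x₂), (2,1)) ⇒ τ y − y ∈ (s)·𝒥ₙ₊₁`. [OURS · L1 W4.5c · R-F15c move 2] -/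
theorem a1m2_admissible (n : ℕ) (y : P) (hy : y ∈ (weightedFiltration (![X₀, x₂] : Fin 2 → P) ![2, 1]).ideal n) :
    τ y - y ∈ Ideal.span {s} * (weightedFiltration (![X₀, x₂] : Fin 2 → P) ![2, 1]).ideal (n + 1) := by
  have hf0 : (![X₀, x₂] : Fin 2 → P) 0 = X₀ := rfl
  have hf1 : (![X₀, x₂] : Fin 2 → P) 1 = x₂ := rfl
  have hw1 : (![2, 1] : Fin 2 → ℕ) 1 = 1 := rfl
  have hJ0 : X₀ ∈ (weightedFiltration (![X₀, x₂] : Fin 2 → P) ![2, 1]).ideal 2 := mem_weightedFiltration_ideal (![X₀, x₂] : Fin 2 → P) ![2, 1] 0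
  have hJ1 : x₂ ∈ (weightedFiltration (![X₀, x₂] : Fin 2 → P) ![2, 1]).ideal 1 := mem_weightedFiltration_ideal (![X₀, x₂] : Fin 2 → P) ![2, 1] 1
  have hsJ : ∀ {m : ℕ} {z : P}, z ∈ (weightedFiltration (![X₀, x₂] : Fin 2 → P) ![2, 1]).ideal m →
      s * z ∈ Ideal.span {s} * (weightedFiltration (![X₀, x₂] : Fin 2 → P) ![2, 1]).ideal m :=
    fun hz => Ideal.mul_mem_mul (Ideal.mem_span_singleton_self s) hz
  have m_s : τ s - s ∈ Ideal.span {s} * (weightedFiltration (![X₀, x₂] : Fin 2 → P) ![2, 1]).ideal 1 := by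
    rw [hs, sub_self]; exact Ideal.zero_mem _
  have m_X₀ : τ X₀ - X₀ ∈ Ideal.span {s} * (weightedFiltration (![X₀, x₂] : Fin 2 → P) ![2, 1]).ideal 1 := by
    rw [hX₀, sub_self]; exact Ideal.zero_mem _
  have m_X₁ : τ X₁ - X₁ ∈ Ideal.span {s} * (weightedFiltration (![X₀, x₂] : Fin 2 → P) ![2, 1]).ideal 1 := by
    rw [hX₁, show X₁ + X₀ * s - X₁ = s * X₀ by ring]
    exact hsJ ((weightedFiltration _ _).antitone (by norm_num : 1 ≤ 2) hJ0)
  have m_x₂ : τ x₂ - x₂ ∈ Ideal.span {s} * (weightedFiltration (![X₀, x₂] : Fin 2 → P) ![2, 1]).ideal 1 := by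
    rw [hx₂, show x₂ + s ^ 2 * X₀ - x₂ = s * (s * X₀) by ring]
    exact hsJ (Ideal.mul_mem_left _ _ ((weightedFiltration _ _).antitone (by norm_num : 1 ≤ 2) hJ0))
  have m_x₃ : τ x₃ - x₃ ∈ Ideal.span {s} * (weightedFiltration (![X₀, x₂] : Fin 2 → P) ![2, 1]).ideal 1 := by
    rw [hx₃, show x₃ + s * X₁ * x₂ - x₃ = s * (X₁ * x₂) by ring]
    exact hsJ (Ideal.mul_mem_left _ _ hJ1)
  refine admissible_of_generators (![X₀, x₂] : Fin 2 → P) ![2, 1] τ s _ hgen ?_ ?_ n y hy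
  · rintro g (hg | hg)
    · simp only [Set.mem_insert_iff, Set.mem_singleton_iff] at hg
      rcases hg with rfl | rfl | rfl | rfl | rfl
      exacts [m_s, m_X₀, m_X₁, m_x₂, m_x₃]
    · rw [hfix g hg, sub_self]; exact Ideal.zero_mem _
  · intro i
    fin_cases i
    · change τ X₀ - X₀ ∈ Ideal.span {s} * (weightedFiltration (![X₀, x₂] : Fin 2 → P) ![2, 1]).ideal (2 + 1)
      rw [hX₀, sub_self]; exact Ideal.zero_mem _
    · change τ x₂ - x₂ ∈ Ideal.span {s} * (weightedFiltration (![X₀, x₂] : Fin 2 → P) ![2, 1]).ideal (1 + 1)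
      rw [hx₂, show x₂ + s ^ 2 * X₀ - x₂ = s * (s * X₀) by ring]
      exact hsJ (Ideal.mul_mem_left _ _ hJ0)

include hs hX₀ hX₁ hx₂ hx₃ hfix hgen in
/-- **`τ`-stability** of the move-2 filtration. -/
theorem a1m2_map_le (n : ℕ) :
    ((weightedFiltration (![X₀, x₂] : Fin 2 → P) ![2, 1]).ideal n).map (τ : P →+* P) ≤ (weightedFiltration (![X₀, x₂] : Fin 2 → P) ![2, 1]).ideal n :=
  map_le_of_admissible (![X₀, x₂] : Fin 2 → P) ![2, 1] τ s (a1m2_admissible τ s X₀ X₁ x₂ x₃ Gfix hs hX₀ hX₁ hx₂ hx₃ hfix hgen) n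

/-! ## (H1) and the residual ideal -/

section Residual

variable {p : ℕ} (hp : 0 < p) (hσp : ∀ x : P, (⇑τ)^[p] x = x)

include hs hX₀ hX₁ hx₂ hx₃ hfix hgen in
/-- ★ **(H1) for move 2**: on `R^w(P) = P[s₂, X₀T₂², x₂T₂]`, `aug σ_R ≤ (s · s₂)`. -/
theorem a1m2_augmentationIdeal_sigmaR_le :
    augmentationIdeal (sigmaR τ (![X₀, x₂] : Fin 2 → P) ![2, 1] (a1m2_map_le τ s X₀ X₁ x₂ x₃ Gfix hs hX₀ hX₁ hx₂ hx₃ hfix hgen) hp hσp) ≤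
      Ideal.span {algebraMap P _ s * cobordantAlgebra.s (![X₀, x₂] : Fin 2 → P) ![2, 1]} :=
  augmentationIdeal_sigmaR_le_span_of_admissible (![X₀, x₂] : Fin 2 → P) ![2, 1] τ _ hp hσp s
    (a1m2_admissible τ s X₀ X₁ x₂ x₃ Gfix hs hX₀ hX₁ hx₂ hx₃ hfix hgen)

include hx₂ in
/-- Row of `Y₂ = x₂T₂`: `σ_R Y₂ − Y₂ = s²·X₀·T₂ = (s s₂)·(s·Y₀)` (`X₀T₂ = Y₀ s₂`). -/
theorem a1m2_sigmaR_u'_one_sub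
    (hσJ : ∀ n : ℕ, ((weightedFiltration (![X₀, x₂] : Fin 2 → P) ![2, 1]).ideal n).map (τ : P →+* P) ≤ (weightedFiltration (![X₀, x₂] : Fin 2 → P) ![2, 1]).ideal n) :
    sigmaR τ (![X₀, x₂] : Fin 2 → P) ![2, 1] hσJ hp hσp (cobordantAlgebra.u' (![X₀, x₂] : Fin 2 → P) ![2, 1] 1) - cobordantAlgebra.u' (![X₀, x₂] : Fin 2 → P) ![2, 1] 1 =
      (algebraMap P _ s * cobordantAlgebra.s (![X₀, x₂] : Fin 2 → P) ![2, 1]) *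
        (algebraMap P _ s * cobordantAlgebra.u' (![X₀, x₂] : Fin 2 → P) ![2, 1] 0) := by
  refine Subtype.ext ?_
  have hu1 : cobordantAlgebra.u' (![X₀, x₂] : Fin 2 → P) ![2, 1] 1 =
      ⟨LaurentPolynomial.C x₂ * LaurentPolynomial.T (((![2, 1] : Fin 2 → ℕ) 1 : ℕ) : ℤ), (cobordantAlgebra.u' (![X₀, x₂] : Fin 2 → P) ![2, 1] 1).2⟩ := rfl
  rw [AddSubgroupClass.coe_sub, MulMemClass.coe_mul, MulMemClass.coe_mul, MulMemClass.coe_mul, cobordantAlgebra.coe_algebraMap, cobordantAlgebra.coe_s,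
    cobordantAlgebra.coe_u', hu1, sigmaR_mk, cobordantAlgebra.coe_u']
  change LaurentPolynomial.C (τ x₂) * LaurentPolynomial.T ((1 : ℕ) : ℤ) - LaurentPolynomial.C x₂ * LaurentPolynomial.T ((1 : ℕ) : ℤ) =
    LaurentPolynomial.C s * LaurentPolynomial.T (-1) * (LaurentPolynomial.C s * (LaurentPolynomial.C X₀ * LaurentPolynomial.T ((2 : ℕ) : ℤ)))
  rw [hx₂, map_add, map_mul, map_pow]
  have hT : LaurentPolynomial.T (-1) * LaurentPolynomial.T ((2 : ℕ) : ℤ) = (LaurentPolynomial.T ((1 : ℕ) : ℤ) : P[T;T⁻¹]) := by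
    rw [← LaurentPolynomial.T_add]; norm_num
  calc (LaurentPolynomial.C x₂ + LaurentPolynomial.C s ^ 2 * LaurentPolynomial.C X₀) * LaurentPolynomial.T ((1 : ℕ) : ℤ) -
        LaurentPolynomial.C x₂ * LaurentPolynomial.T ((1 : ℕ) : ℤ)
      = LaurentPolynomial.C s ^ 2 * LaurentPolynomial.C X₀ * (LaurentPolynomial.T (-1) * LaurentPolynomial.T ((2 : ℕ) : ℤ)) := by rw [hT]; ring
    _ = _ := by ring

include hX₁ in
/-- Row of `X₁`: `σ_R X₁ − X₁ = X₀·s = (s s₂)·(Y₀ s₂)`. -/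
theorem a1m2_sigmaR_X₁_sub
    (hσJ : ∀ n : ℕ, ((weightedFiltration (![X₀, x₂] : Fin 2 → P) ![2, 1]).ideal n).map (τ : P →+* P) ≤ (weightedFiltration (![X₀, x₂] : Fin 2 → P) ![2, 1]).ideal n) :
    sigmaR τ (![X₀, x₂] : Fin 2 → P) ![2, 1] hσJ hp hσp (algebraMap P _ X₁) - algebraMap P _ X₁ =
      (algebraMap P _ s * cobordantAlgebra.s (![X₀, x₂] : Fin 2 → P) ![2, 1]) *
        (cobordantAlgebra.u' (![X₀, x₂] : Fin 2 → P) ![2, 1] 0 * cobordantAlgebra.s (![X₀, x₂] : Fin 2 → P) ![2, 1]) := by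
  refine Subtype.ext ?_
  rw [AddSubgroupClass.coe_sub, MulMemClass.coe_mul, MulMemClass.coe_mul, MulMemClass.coe_mul, sigmaR_algebraMap, cobordantAlgebra.coe_algebraMap,
    cobordantAlgebra.coe_algebraMap, cobordantAlgebra.coe_algebraMap, cobordantAlgebra.coe_s, cobordantAlgebra.coe_u']
  change LaurentPolynomial.C (τ X₁) - LaurentPolynomial.C X₁ =
    LaurentPolynomial.C s * LaurentPolynomial.T (-1) * (LaurentPolynomial.C X₀ * LaurentPolynomial.T ((2 : ℕ) : ℤ) * LaurentPolynomial.T (-1))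
  rw [hX₁, map_add, map_mul]
  have hT : LaurentPolynomial.T (-1) * (LaurentPolynomial.T ((2 : ℕ) : ℤ) * LaurentPolynomial.T (-1)) = (1 : P[T;T⁻¹]) := by
    rw [← LaurentPolynomial.T_add, ← LaurentPolynomial.T_add]; norm_num
  calc LaurentPolynomial.C X₁ + LaurentPolynomial.C X₀ * LaurentPolynomial.C s - LaurentPolynomial.C X₁
      = LaurentPolynomial.C X₀ * LaurentPolynomial.C s * (LaurentPolynomial.T (-1) * (LaurentPolynomial.T ((2 : ℕ) : ℤ) * LaurentPolynomial.T (-1))) := by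
        rw [hT]; ring
    _ = _ := by ring

include hx₃ in
/-- Row of `x₃`: `σ_R x₃ − x₃ = s·X₁·x₂ = (s s₂)·(X₁·Y₂)`. -/
theorem a1m2_sigmaR_x₃_sub
    (hσJ : ∀ n : ℕ, ((weightedFiltration (![X₀, x₂] : Fin 2 → P) ![2, 1]).ideal n).map (τ : P →+* P) ≤ (weightedFiltration (![X₀, x₂] : Fin 2 → P) ![2, 1]).ideal n) :
    sigmaR τ (![X₀, x₂] : Fin 2 → P) ![2, 1] hσJ hp hσp (algebraMap P _ x₃) - algebraMap P _ x₃ =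
      (algebraMap P _ s * cobordantAlgebra.s (![X₀, x₂] : Fin 2 → P) ![2, 1]) *
        (algebraMap P _ X₁ * cobordantAlgebra.u' (![X₀, x₂] : Fin 2 → P) ![2, 1] 1) := by
  refine Subtype.ext ?_
  rw [AddSubgroupClass.coe_sub, MulMemClass.coe_mul, MulMemClass.coe_mul, MulMemClass.coe_mul, sigmaR_algebraMap, cobordantAlgebra.coe_algebraMap,
    cobordantAlgebra.coe_algebraMap, cobordantAlgebra.coe_algebraMap, cobordantAlgebra.coe_algebraMap, cobordantAlgebra.coe_s, cobordantAlgebra.coe_u']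
  change LaurentPolynomial.C (τ x₃) - LaurentPolynomial.C x₃ =
    LaurentPolynomial.C s * LaurentPolynomial.T (-1) * (LaurentPolynomial.C X₁ * (LaurentPolynomial.C x₂ * LaurentPolynomial.T ((1 : ℕ) : ℤ)))
  rw [hx₃, map_add, map_mul, map_mul]
  have hT : LaurentPolynomial.T (-1) * LaurentPolynomial.T ((1 : ℕ) : ℤ) = (1 : P[T;T⁻¹]) := by
    rw [← LaurentPolynomial.T_add]; norm_num
  calc LaurentPolynomial.C x₃ + LaurentPolynomial.C s * LaurentPolynomial.C X₁ * LaurentPolynomial.C x₂ - LaurentPolynomial.C x₃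
      = LaurentPolynomial.C s * LaurentPolynomial.C X₁ * LaurentPolynomial.C x₂ * (LaurentPolynomial.T (-1) * LaurentPolynomial.T ((1 : ℕ) : ℤ)) := by
        rw [hT]; ring
    _ = _ := by ring

include hs hX₀ hX₁ hx₂ hx₃ hfix hgen in
/-- ★ **`Y₀·s ∈ 𝔞₂`**, ★ **`Y₀·s₂ ∈ 𝔞₂`**, ★ **`X₁·Y₂ ∈ 𝔞₂`** — the residual ideal `(aug σ_R : s·s₂)` of move 2 contains F13's generators. -/
theorem a1m2_residual_mem :
    algebraMap P _ s * cobordantAlgebra.u' (![X₀, x₂] : Fin 2 → P) ![2, 1] 0 ∈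
        (augmentationIdeal (sigmaR τ (![X₀, x₂] : Fin 2 → P) ![2, 1] (a1m2_map_le τ s X₀ X₁ x₂ x₃ Gfix hs hX₀ hX₁ hx₂ hx₃ hfix hgen) hp hσp)).colon
          (Ideal.span {algebraMap P _ s * cobordantAlgebra.s (![X₀, x₂] : Fin 2 → P) ![2, 1]}) ∧
      cobordantAlgebra.u' (![X₀, x₂] : Fin 2 → P) ![2, 1] 0 * cobordantAlgebra.s (![X₀, x₂] : Fin 2 → P) ![2, 1] ∈
        (augmentationIdeal (sigmaR τ (![X₀, x₂] : Fin 2 → P) ![2, 1] (a1m2_map_le τ s X₀ X₁ x₂ x₃ Gfix hs hX₀ hX₁ hx₂ hx₃ hfix hgen) hp hσp)).colon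
          (Ideal.span {algebraMap P _ s * cobordantAlgebra.s (![X₀, x₂] : Fin 2 → P) ![2, 1]}) ∧
      algebraMap P _ X₁ * cobordantAlgebra.u' (![X₀, x₂] : Fin 2 → P) ![2, 1] 1 ∈
        (augmentationIdeal (sigmaR τ (![X₀, x₂] : Fin 2 → P) ![2, 1] (a1m2_map_le τ s X₀ X₁ x₂ x₃ Gfix hs hX₀ hX₁ hx₂ hx₃ hfix hgen) hp hσp)).colon
          (Ideal.span {algebraMap P _ s * cobordantAlgebra.s (![X₀, x₂] : Fin 2 → P) ![2, 1]}) := by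
  refine ⟨?_, ?_, ?_⟩
  · rw [Ideal.mem_colon_span_singleton, mul_comm, ← a1m2_sigmaR_u'_one_sub τ s X₀ x₂ hx₂ hp hσp]
    exact sub_mem_augmentationIdeal _ _
  · rw [Ideal.mem_colon_span_singleton, mul_comm, ← a1m2_sigmaR_X₁_sub τ s X₀ X₁ x₂ hX₁ hp hσp]
    exact sub_mem_augmentationIdeal _ _
  · rw [Ideal.mem_colon_span_singleton, mul_comm, ← a1m2_sigmaR_x₃_sub τ s X₀ X₁ x₂ x₃ hx₃ hp hσp]
    exact sub_mem_augmentationIdeal _ _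

end Residual

end Summit.ResolutionOfSingularities.ResolutionOfSingularities.Theorems.WildQuotientResolution.S1.KillCert.A1

end
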